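import Literature.Analysis.FluidPDE.SelfSimilarCollapseAnsatz
import Literature.Analysis.FluidPDE.BoundedAnnihilator
import Literature.Analysis.FluidPDE.HarmonicLiouvilleLp
import HarnessLib

/-!
# Viscous rigidity of EXACT discrete scaling covariance (DSS) with the wrong exponent

Summit `NavierStokesRegularity`, cell topic directory `FluidComputer`, namespace
`…FluidComputer.SelfSimilarCensus` (kernel side of the `ns-blowup` cell's self-similar census
`selfsim/SELFSIM-NOGO.md`, row (M16-DSS)); companion to `SelfSimilarCollapseViscousRigidity.lean`
(the continuously self-similar case; not imported). PROVED theorems only; no data, no named facts.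

## The observation

Fix a blow-up time `T`, an exponent `γ`, and ONE scale factor `q ∈ (0, 1)`. Call a pair `(u, p)`
**`(γ, q)`-scaling covariant** on the parabolic neighbourhood `{T − δ < t < T} × B(0, r)` if

  `u(T − q(T−t), q^γ x) = q^{γ−1} u(t, x)`,  `p(T − q(T−t), q^γ x) = q^{2γ−2} p(t, x)`  there.

Every power-law DISCRETELY self-similar pair (profile periodic in `log(T−t)`) is covariant for
its `q = e^{−period}`; an exactly self-similar pair (`SelfSimilarCollapseAnsatz.lean`) is covariant
for every `q`. Differentiating the covariance at a point `(t, x)` and at its image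
`(t′, x′) = (T − q(T−t), q^γ x)` gives

  `∂ₜu(t′,x′) = q^{γ−2} ∂ₜu(t,x)`, `(u·∇)u(t′,x′) = q^{γ−2} (u·∇)u(t,x)`, `∇p(t′,x′) = q^{γ−2} ∇p(t,x)`,
  but `Δu(t′,x′) = q^{−1−γ} Δu(t,x)`.

Hence if the Navier–Stokes momentum equation holds at both points and `ν ≠ 0`, then
`(q^{γ−2} − q^{−1−γ}) Δu(t,x) = 0`, and `q^{γ−2} ≠ q^{−1−γ}` exactly when `γ ≠ ½`: **an exact
`(γ,q)`-covariant Navier–Stokes pair with `γ ≠ ½` is harmonic in space at every time**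
(`laplacian_eq_zero_of_dss_covariant`). Navier–Stokes has only the parabolic scaling
`u ↦ λu(λx, λ²t)` (`γ = ½`; Leray 1934; Nečas–Růžička–Šverák 1996; the λ-DSS class of Tsai,
Bradshaw–Tsai, Chae–Wolf); this file is the quantitative form of "only". If the covariance and the
equation hold on all of `ℝ³` for `t ∈ (T−δ, T)` and `u(t, ·)` is bounded, Liouville makes `u(t, ·)`
CONSTANT (`velocity_eq_const_of_dss_covariant`) and the velocity gradient (strain and vorticity)
vanishes identically (`fderiv_eq_zero_of_dss_covariant`). No symmetry class, swirl, energy or incompressibility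
hypothesis enters.

For the census: SELFSIM-NOGO (M6)(iii)/(M13)/(M14) excluded power-law DSS with `γ ≠ ½` inside the
AXISYMMETRIC class (Type-I exclusion of Koch–Nadirashvili–Seregin–Šverák for `γ ≥ ½`, the
circulation bound for `γ < ½` with swirl). For EXACT covariance this file removes the symmetry
hypothesis: in every class, `γ = ½` is the only exponent an exact power-law DSS Navier–Stokes
blow-up can have — the object of the cell `pub-ns-dss` and of zone Z2 of the profile search.

## WHAT THIS IS NOT

Not a statement about λ-DSS at `γ = ½` (untouched), nor about ASYMPTOTICALLY or log-modulated
self-similar blow-up (no exact covariance there), nor a regularity theorem (the step from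
"irrotational / constant near the singular point" to "regular point" belongs to the solution
class). The pressure covariance is part of the hypothesis (as in every printed DSS ansatz).

## Mathlib / tree search

`lean search 'DSS|discretely self-similar|scaling covariant'`: the tree's DSS material is the
`γ = ½` class only (`Tsai2014ForwardDSS`, `BradshawTsaiDSSExistenceHolds`, `ForwardDSSLocalLeray*`,
`PineauVicolRDSSLeray`, `chaeWolf2017_removing_dss`); no wrong-exponent rigidity statement.
Tools: Mathlib `InnerProductSpace.laplacian_congr_nhds`, `Filter.EventuallyEq.fderiv_eq/deriv_eq`,
`HasDerivAt.scomp`, `Real.rpow_lt_rpow_of_exponent_gt`; tree `laplacian_const_smul_comp_smul`,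
`fderiv_const_smul_comp_smul'`, `InnerProductSpace.HarmonicOnNhd.apply_eq_apply_of_abs_le`,
`harmonicOnNhd_of_laplacian_eq_zero`.

## References

* J. Leray, Acta Math. 63 (1934), (3.11)–(3.12). [Leray1934]
* J. Nečas, M. Růžička, V. Šverák, Acta Math. 176 (1996), Introduction. [NecasRuzickaSverak1996]
* T.-P. Tsai, Comm. Math. Phys. 328 (2014) (λ-DSS solutions: the `γ = ½` class). [Tsai2014]
-/

noncomputable section

open Set Filter Topology InnerProductSpace Metric
open scoped Laplacian RealInnerProductSpace

namespace Summit.NavierStokesRegularity.FluidComputer.SelfSimilarCensus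

open Literature.Analysis.FluidPDE

section DssRigidity

variable {γ T ν δ r q : ℝ}
  {u : ℝ → EuclideanSpace ℝ (Fin 3) → EuclideanSpace ℝ (Fin 3)}
  {p : ℝ → EuclideanSpace ℝ (Fin 3) → ℝ}

/-- The image time `t′ = T − q(T − t)` of `t ∈ (T−δ, T)` under the scaling with factor
`q ∈ (0, 1)` lies again in `(T−δ, T)`. [folklore] -/
theorem scaledTime_mem_Ioo (hq0 : 0 < q) (hq1 : q < 1) {t : ℝ}
    (ht : t ∈ Ioo (T - δ) T) : T - q * (T - t) ∈ Ioo (T - δ) T := by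
  obtain ⟨h1, h2⟩ := ht
  have hTt : 0 < T - t := by linarith
  constructor
  · nlinarith [mul_lt_mul_of_pos_right hq1 hTt]
  · nlinarith [mul_pos hq0 hTt]

/-- The image point `x′ = q^γ • x` of `x ∈ B(0, r)` lies again in `B(0, r)` for `q ∈ (0,1)`,
`γ > 0`. [folklore] -/
theorem scaledPoint_mem_ball (hq0 : 0 < q) (hq1 : q < 1) (hγ0 : 0 < γ)
    {x : EuclideanSpace ℝ (Fin 3)} (hx : x ∈ ball (0 : EuclideanSpace ℝ (Fin 3)) r) :
    q ^ γ • x ∈ ball (0 : EuclideanSpace ℝ (Fin 3)) r := by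
  rw [mem_ball_zero_iff] at hx ⊢
  rw [norm_smul, Real.norm_of_nonneg (Real.rpow_nonneg hq0.le γ)]
  have h1 : q ^ γ ≤ 1 := Real.rpow_le_one hq0.le hq1.le hγ0.le
  calc q ^ γ * ‖x‖ ≤ 1 * ‖x‖ := mul_le_mul_of_nonneg_right h1 (norm_nonneg _)
    _ < r := by rw [one_mul]; exact hx

/-- `q^{−γ} • (q^{γ} • x) = x` for `q > 0`. [folklore] -/
theorem rpow_neg_smul_rpow_smul' (hq0 : 0 < q) (γ : ℝ) (x : EuclideanSpace ℝ (Fin 3)) :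
    q ^ (-γ) • (q ^ γ • x) = x := by
  rw [smul_smul, ← Real.rpow_add hq0, neg_add_cancel, Real.rpow_zero, one_smul]

/-- For `q ∈ (0, 1)` and `γ ≠ ½` the two scaling weights differ: `q^{γ−2} ≠ q^{−1−γ}`
(the exponents coincide iff `γ = ½`). [folklore] -/
theorem rpow_weights_ne (hq0 : 0 < q) (hq1 : q < 1) (hγ : γ ≠ 1 / 2) :
    q ^ (γ - 2) ≠ q ^ (-1 - γ) := by
  rcases lt_or_gt_of_ne hγ with h | h
  · have hlt : γ - 2 < -1 - γ := by linarith
    exact (Real.rpow_lt_rpow_of_exponent_gt hq0 hq1 hlt).ne'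
  · have hlt : -1 - γ < γ - 2 := by linarith
    exact (Real.rpow_lt_rpow_of_exponent_gt hq0 hq1 hlt).ne

/-- **DSS viscous rigidity (local harmonicity).** Let `q ∈ (0,1)`, `γ > 0`, `γ ≠ ½`, `ν ≠ 0`,
`δ, r` arbitrary. Suppose `(u, p)` is `(γ, q)`-scaling covariant on `{T−δ < t < T} × B(0, r)`:
`u(T − q(T−t), q^γ x) = q^{γ−1} u(t, x)` and `p(T − q(T−t), q^γ x) = q^{2γ−2} p(t, x)` there; that
each `t ↦ u(t, x)` is differentiable on `(T−δ, T)` (no spatial regularity is needed: the identity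
is algebraic in the derivative symbols, Mathlib's junk values included); and that the
Navier–Stokes momentum equation `∂ₜu + (u·∇)u + ∇p − νΔu = 0` holds pointwise there. Then
`Δu(t, x) = 0` at every point of the neighbourhood. Proof: compare the equation at `(t, x)` and at
the image point `(T − q(T−t), q^γ x)`, where every inertial term carries the weight `q^{γ−2}` and
the viscous term the weight `q^{−1−γ}`. [folklore] -/
theorem laplacian_eq_zero_of_dss_covariant (hq0 : 0 < q) (hq1 : q < 1) (hγ0 : 0 < γ)
    (hγ : γ ≠ 1 / 2) (hν : ν ≠ 0)
    (hut : ∀ t ∈ Ioo (T - δ) T, ∀ x, DifferentiableAt ℝ (fun s => u s x) t)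
    (hcov : ∀ t ∈ Ioo (T - δ) T, ∀ x ∈ ball (0 : EuclideanSpace ℝ (Fin 3)) r,
      u (T - q * (T - t)) (q ^ γ • x) = q ^ (γ - 1) • u t x)
    (hcovp : ∀ t ∈ Ioo (T - δ) T, ∀ x ∈ ball (0 : EuclideanSpace ℝ (Fin 3)) r,
      p (T - q * (T - t)) (q ^ γ • x) = q ^ (2 * γ - 2) * p t x)
    (hNS : ∀ t ∈ Ioo (T - δ) T, ∀ x ∈ ball (0 : EuclideanSpace ℝ (Fin 3)) r,
      timeDeriv u t x + convect (u t) (u t) x + gradient (p t) x - ν • (Δ (u t)) x = 0)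
    {t : ℝ} (ht : t ∈ Ioo (T - δ) T) {x : EuclideanSpace ℝ (Fin 3)}
    (hx : x ∈ ball (0 : EuclideanSpace ℝ (Fin 3)) r) :
    (Δ (u t)) x = 0 := by
  -- the image point
  set t' : ℝ := T - q * (T - t) with ht'def
  set x' : EuclideanSpace ℝ (Fin 3) := q ^ γ • x with hx'def
  have ht' : t' ∈ Ioo (T - δ) T := scaledTime_mem_Ioo hq0 hq1 ht
  have hx' : x' ∈ ball (0 : EuclideanSpace ℝ (Fin 3)) r := scaledPoint_mem_ball hq0 hq1 hγ0 hx
  have hqne : q ≠ 0 := hq0.ne'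
  have hqγ : q ^ γ ≠ 0 := (Real.rpow_pos_of_pos hq0 γ).ne'
  have hqnγ : q ^ (-γ) ≠ 0 := (Real.rpow_pos_of_pos hq0 (-γ)).ne'
  have hback : q ^ (-γ) • x' = x := rpow_neg_smul_rpow_smul' hq0 γ x
  -- (N1) spatial covariance as a local identity of functions near x'
  have hball : ball (0 : EuclideanSpace ℝ (Fin 3)) (q ^ γ * r) ∈ 𝓝 x' := by
    apply isOpen_ball.mem_nhds
    rw [mem_ball_zero_iff] at hx ⊢
    rw [hx'def, norm_smul, Real.norm_of_nonneg (Real.rpow_nonneg hq0.le γ)]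
    exact mul_lt_mul_of_pos_left hx (Real.rpow_pos_of_pos hq0 γ)
  have hpre : ∀ z ∈ ball (0 : EuclideanSpace ℝ (Fin 3)) (q ^ γ * r),
      q ^ (-γ) • z ∈ ball (0 : EuclideanSpace ℝ (Fin 3)) r := by
    intro z hz
    rw [mem_ball_zero_iff] at hz ⊢
    rw [norm_smul, Real.norm_of_nonneg (Real.rpow_nonneg hq0.le _)]
    have hq' : q ^ (-γ) * (q ^ γ * r) = r := by
      rw [← mul_assoc, ← Real.rpow_add hq0, neg_add_cancel, Real.rpow_zero, one_mul]
    calc q ^ (-γ) * ‖z‖ < q ^ (-γ) * (q ^ γ * r) :=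
          mul_lt_mul_of_pos_left hz (Real.rpow_pos_of_pos hq0 _)
      _ = r := hq'
  have hsm : ∀ z : EuclideanSpace ℝ (Fin 3), q ^ γ • (q ^ (-γ) • z) = z := fun z => by
    rw [smul_smul, ← Real.rpow_add hq0, add_neg_cancel, Real.rpow_zero, one_smul]
  have N1 : u t' =ᶠ[𝓝 x'] fun z => q ^ (γ - 1) • u t (q ^ (-γ) • z) := by
    filter_upwards [hball] with z hz
    have h := hcov t ht (q ^ (-γ) • z) (hpre z hz)
    rw [hsm z] at h
    exact h
  have N2 : p t' =ᶠ[𝓝 x'] fun z => q ^ (2 * γ - 2) • p t (q ^ (-γ) • z) := by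
    filter_upwards [hball] with z hz
    have h := hcovp t ht (q ^ (-γ) • z) (hpre z hz)
    rw [hsm z] at h
    rw [smul_eq_mul]
    exact h
  -- (N3) temporal covariance as a local identity of functions of time near t'
  have hIoo : Ioo (T - q * δ) T ∈ 𝓝 t' := by
    apply Ioo_mem_nhds
    · rw [ht'def]; nlinarith [ht.1, mul_pos hq0 (show 0 < T - t by linarith [ht.2])]
    · exact ht'.2
  have N3 : (fun s => u s x') =ᶠ[𝓝 t'] fun s => q ^ (γ - 1) • u (T - (T - s) / q) x := by
    filter_upwards [hIoo] with s hs
    have hσ : T - (T - s) / q ∈ Ioo (T - δ) T := by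
      obtain ⟨hs1, hs2⟩ := hs
      constructor
      · have : (T - s) / q < δ := by
          rw [div_lt_iff₀ hq0]; linarith
        linarith
      · have : 0 < (T - s) / q := div_pos (by linarith) hq0
        linarith
    have h := hcov (T - (T - s) / q) hσ x hx
    have e : T - q * (T - (T - (T - s) / q)) = s := by field_simp; ring
    rw [e] at h
    exact h
  -- the four derivative identities at (t', x')
  have hΔ : (Δ (u t')) x' = q ^ (-1 - γ) • (Δ (u t)) x := by
    rw [(laplacian_congr_nhds N1).eq_of_nhds, laplacian_const_smul_comp_smul _ _ hqnγ, hback,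
      show q ^ (γ - 1) * (q ^ (-γ)) ^ 2 = q ^ (-1 - γ) by
        rw [sq, ← Real.rpow_add hq0, ← Real.rpow_add hq0]; congr 1; ring]
  have hD : fderiv ℝ (u t') x' = (q ^ (γ - 1) * q ^ (-γ)) • fderiv ℝ (u t) x := by
    rw [N1.fderiv_eq, fderiv_const_smul_comp_smul', hback]
  have hval : u t' x' = q ^ (γ - 1) • u t x := hcov t ht x hx
  have hconv : convect (u t') (u t') x' = q ^ (γ - 2) • convect (u t) (u t) x := by
    rw [convect, convect, hD, hval]
    change (q ^ (γ - 1) * q ^ (-γ)) • (fderiv ℝ (u t) x) (q ^ (γ - 1) • u t x) = _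
    rw [map_smul, smul_smul,
      show q ^ (γ - 1) * q ^ (-γ) * q ^ (γ - 1) = q ^ (γ - 2) by
        rw [← Real.rpow_add hq0, ← Real.rpow_add hq0]; congr 1; ring]
  have hgrad : gradient (p t') x' = q ^ (γ - 2) • gradient (p t) x := by
    rw [N2.gradient_eq]
    rw [gradient, fderiv_const_smul_comp_smul', map_smul, ← gradient, hback,
      show q ^ (2 * γ - 2) * q ^ (-γ) = q ^ (γ - 2) by rw [← Real.rpow_add hq0]; congr 1; ring]
  have htime : timeDeriv u t' x' = q ^ (γ - 2) • timeDeriv u t x := by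
    rw [timeDeriv, timeDeriv, N3.deriv_eq]
    have hσt : T - (T - t') / q = t := by rw [ht'def]; field_simp; ring
    have hg : HasDerivAt (fun τ => u τ x) (deriv (fun τ => u τ x) t) (T - (T - t') / q) := by
      rw [hσt]; exact (hut t ht x).hasDerivAt
    have hσ : HasDerivAt (fun s : ℝ => T - (T - s) / q) (q⁻¹) t' :=
      ((((hasDerivAt_id t').const_sub T).div_const q).const_sub T).congr_deriv
        (by rw [neg_div, neg_neg, one_div])
    have hcomp : HasDerivAt (fun s => q ^ (γ - 1) • u (T - (T - s) / q) x)
        (q ^ (γ - 1) • q⁻¹ • deriv (fun τ => u τ x) t) t' :=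
      (hg.scomp t' hσ).const_smul (q ^ (γ - 1))
    rw [hcomp.deriv, smul_smul,
      show q ^ (γ - 1) * q⁻¹ = q ^ (γ - 2) by
        rw [← Real.rpow_neg_one, ← Real.rpow_add hq0]; congr 1; ring]
  -- compare the two equations
  have E1 := hNS t ht x hx
  have E2 := hNS t' ht' x' hx'
  rw [htime, hconv, hgrad, hΔ] at E2
  have E1' : timeDeriv u t x + convect (u t) (u t) x + gradient (p t) x = ν • (Δ (u t)) x :=
    sub_eq_zero.mp E1
  have E3 : (ν * (q ^ (γ - 2) - q ^ (-1 - γ))) • (Δ (u t)) x = 0 := by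
    have : q ^ (γ - 2) • (timeDeriv u t x + convect (u t) (u t) x + gradient (p t) x) -
        ν • q ^ (-1 - γ) • (Δ (u t)) x = 0 := by
      rw [smul_add, smul_add]; exact E2
    rw [E1', smul_smul, smul_smul, ← sub_smul] at this
    convert this using 2
    ring
  exact (smul_eq_zero.mp E3).resolve_left (mul_ne_zero hν (sub_ne_zero.mpr (rpow_weights_ne hq0 hq1 hγ)))

/-- **DSS viscous rigidity (global: constant slices).** If the `(γ, q)`-covariance
(`q ∈ (0,1)`, `γ > 0`, `γ ≠ ½`) and the Navier–Stokes momentum equation with `ν ≠ 0` hold for all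
`x ∈ ℝ³` and `t ∈ (T−δ, T)`, with `C²` slices, differentiable time lines and BOUNDED slices
(`‖u(t, x)‖ ≤ M t`), then every slice is constant: `u(t, x) = u(t, 0)`. (Harmonic by
`laplacian_eq_zero_of_dss_covariant` on every ball, then Liouville per component.) [folklore] -/
theorem velocity_eq_const_of_dss_covariant (hq0 : 0 < q) (hq1 : q < 1) (hγ0 : 0 < γ)
    (hγ : γ ≠ 1 / 2) (hν : ν ≠ 0)
    (hu : ∀ t ∈ Ioo (T - δ) T, ContDiff ℝ 2 (u t))
    (hut : ∀ t ∈ Ioo (T - δ) T, ∀ x, DifferentiableAt ℝ (fun s => u s x) t)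
    (hcov : ∀ t ∈ Ioo (T - δ) T, ∀ x, u (T - q * (T - t)) (q ^ γ • x) = q ^ (γ - 1) • u t x)
    (hcovp : ∀ t ∈ Ioo (T - δ) T, ∀ x, p (T - q * (T - t)) (q ^ γ • x) = q ^ (2 * γ - 2) * p t x)
    (hNS : ∀ t ∈ Ioo (T - δ) T, ∀ x,
      timeDeriv u t x + convect (u t) (u t) x + gradient (p t) x - ν • (Δ (u t)) x = 0)
    {M : ℝ → ℝ} (hM : ∀ t ∈ Ioo (T - δ) T, ∀ x, ‖u t x‖ ≤ M t)
    {t : ℝ} (ht : t ∈ Ioo (T - δ) T) (x : EuclideanSpace ℝ (Fin 3)) : u t x = u t 0 := by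
  have hΔ : ∀ y, (Δ (u t)) y = 0 := fun y =>
    laplacian_eq_zero_of_dss_covariant (T := T) (p := p) (r := ‖y‖ + 1) hq0 hq1 hγ0 hγ hν
      hut (fun s hs z _ => hcov s hs z) (fun s hs z _ => hcovp s hs z)
      (fun s hs z _ => hNS s hs z) ht (by rw [mem_ball_zero_iff]; linarith)
  have hharm : HarmonicOnNhd (u t) univ := harmonicOnNhd_of_laplacian_eq_zero (hu t ht) hΔ
  apply ext_inner_left ℝ
  intro a
  have hcomp : HarmonicOnNhd (⇑(innerSL ℝ a) ∘ u t) univ := hharm.comp_CLM (innerSL ℝ a)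
  have hbdd : ∀ z, |(⇑(innerSL ℝ a) ∘ u t) z| ≤ ‖a‖ * M t := fun z => by
    rw [Function.comp_apply, innerSL_apply_apply ℝ]
    exact (abs_real_inner_le_norm a (u t z)).trans
      (mul_le_mul_of_nonneg_left (hM t ht z) (norm_nonneg a))
  have := hcomp.apply_eq_apply_of_abs_le hbdd x 0
  simpa [Function.comp_apply, innerSL_apply_apply ℝ] using this

/-- **Census form (SELFSIM-NOGO (M16-DSS)).** Under the hypotheses of
`velocity_eq_const_of_dss_covariant` — an exact `(γ, q)`-scaling covariant Navier–Stokes pair on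
`ℝ³ × (T−δ, T)` with `q ∈ (0,1)`, `γ > 0`, `γ ≠ ½`, `ν ≠ 0` and bounded `C²` slices — the velocity
GRADIENT vanishes identically: `Du(t, ·) ≡ 0` for `t ∈ (T−δ, T)` (no strain, no vorticity). So an
exact power-law discretely self-similar Navier–Stokes blow-up with bounded rescaled velocity has
`γ = ½` in EVERY symmetry class (no axisymmetry, swirl, energy or incompressibility hypothesis);
`γ = ½` itself (λ-DSS) is untouched. [folklore] -/
theorem fderiv_eq_zero_of_dss_covariant (hq0 : 0 < q) (hq1 : q < 1) (hγ0 : 0 < γ)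
    (hγ : γ ≠ 1 / 2) (hν : ν ≠ 0)
    (hu : ∀ t ∈ Ioo (T - δ) T, ContDiff ℝ 2 (u t))
    (hut : ∀ t ∈ Ioo (T - δ) T, ∀ x, DifferentiableAt ℝ (fun s => u s x) t)
    (hcov : ∀ t ∈ Ioo (T - δ) T, ∀ x, u (T - q * (T - t)) (q ^ γ • x) = q ^ (γ - 1) • u t x)
    (hcovp : ∀ t ∈ Ioo (T - δ) T, ∀ x, p (T - q * (T - t)) (q ^ γ • x) = q ^ (2 * γ - 2) * p t x)
    (hNS : ∀ t ∈ Ioo (T - δ) T, ∀ x,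
      timeDeriv u t x + convect (u t) (u t) x + gradient (p t) x - ν • (Δ (u t)) x = 0)
    {M : ℝ → ℝ} (hM : ∀ t ∈ Ioo (T - δ) T, ∀ x, ‖u t x‖ ≤ M t)
    {t : ℝ} (ht : t ∈ Ioo (T - δ) T) (x : EuclideanSpace ℝ (Fin 3)) :
    fderiv ℝ (u t) x = 0 := by
  have hconst : u t = fun _ => u t 0 := funext fun y =>
    velocity_eq_const_of_dss_covariant (T := T) (p := p) hq0 hq1 hγ0 hγ hν hu hut hcov hcovp
      hNS hM ht y
  rw [hconst, fderiv_const_apply]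

end DssRigidity

end Summit.NavierStokesRegularity.FluidComputer.SelfSimilarCensus

end
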